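import Summits.CriticalPhenomena.PercolationContinuityZ3.Theorems.PercNearOneGluingNoHeavyQuantFarEarHairLaw
import Summits.CriticalPhenomena.PercolationContinuityZ3.Theorems.PercNearOneGluingNoHeavyQuantFarEarHairCells
import Summits.CriticalPhenomena.PercolationContinuityZ3.Theorems.PercNearOneGluingNoHeavyQuantFarEarHairArithMaster
import HarnessLib

/-!
# QUANT lane R8, front "FAR beyond trees", layer one — **FAR(1) HOLDS ON EVERY GRAPH WITH A HAIRED EAR AT THE OBSERVER**

builds on p205010 (kernel theorem, internal audit signed; external expert review pending)

Support file (`--supports stmt-CriticalPhenomena-4575`), seat `prim-quant-p1` (gen 27); memo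
`run/shared/lean/prim/quant/prim-quant-p1-g27/FOR-LEAD-HAIR.md`.  Standard axioms; no sorries; no definitions.

**THEOREM (`Quant.farLayerOne_of_earHairAtObserver`).**  Let `w` be any weight function on the pairs of `Fin n`, `A` a relay set,
`o` the observer.  Suppose a relay `v ∈ A` (`v ≠ o`) has positive weight only towards `o` (`s(o,v)`, weight `p`) and towards ONE further
vertex `u ≠ o` (`s(v,u)`, weight `r`; `u` may or may not be a relay and has arbitrary further pairs), and that `u` carries a PENDANT relay
`h ∈ A` (`s(u,h)` of weight `s` is the only positive pair at `h`).  Then the layer-one instance of `Quant.FarRelayRow` holds at `(w, A, o)`: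
`2 < Σ_{a∈A} P(o ↔ a)` and `P(o ↮ a) ≤ t` for all `a ∈ A` imply `P(#{a ∈ A : o ↔ a} ≤ 1) ≤ t`.

Part 1 (`EarHair.real_card_le_one_eq`): the law of the event `N ≤ 1`, by conditioning on the eight states of the three independent pairs
(file I's `card_eq`): `P(N ≤ 1) = p r (1−s)·P(K = 0, F = 0) + p(1−r)s·P(¬G, K = 0) + p(1−r)(1−s)·P(K = 0) + (1−p) r s·P(¬G, K ≤ 1)
 + [(1−p) r (1−s) + (1−p)(1−r) s]·P((¬G ∧ K ≤ 1) ∨ (G ∧ K = 0)) + (1−p)(1−r)(1−s)·P(K ≤ 1)` (`G = [o ~ u off Z]`, `K = #{b ∈ A″ : o ~ b off Z}`,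
`F = #{b ∈ A″ : o ≁ b, u ~ b off Z}`, `Z = {v,h}`, `A″ = A ∖ {v,h}`).
Part 2 (the theorem): the cells of `…EarHairCells`, the marginals of `…EarHairLaw`, ONE Harris row (`P(G)·P(K ≥ 1) ≤ P(G, K ≥ 1)`) and the
bookkeeping inequality `…EarHairArithMaster`.  This is the HAIR GENERALISATION of p1 g26's `Quant.farLayerOne_of_earAtObserver` (which is
the case `u ∈ A`; at `p = 0` it is p1 g24's cherry); unlike that case it is NOT provable by pure bookkeeping (memo §1: Harris-violating
pseudo-laws at small `p`).  New unconditional layer-one coverage: every graph in which the observer is adjacent to a degree-two relay whose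
other neighbour carries a pendant relay.
[cite: KozmaNitzan2024, Conjecture 3 (p. 15)] (the row served); [cite: Grimmett1999, §1.3 p. 10, §2.2, Thm. (2.4) p. 34]; [this work].
-/

noncomputable section

namespace Summit.CriticalPhenomena.PercolationContinuityZ3.Theorems

namespace Quant

namespace EarHair

open Finset MeasureTheory Set
open Literature.Probability.LatticeModels
open Literature.Probability.Percolation
open Bundle (offZ reachable_of_offZ)
open scoped Classical

variable {n : ℕ} {o v u h : Fin n}

section Law

variable (w : Sym2 (Fin n) → unitInterval)
  (hwv : ∀ z : Fin n, z ≠ o → z ≠ u → z ≠ v → (w s(v, z) : ℝ) = 0) (hwh : ∀ z : Fin n, z ≠ u → z ≠ h → (w s(h, z) : ℝ) = 0)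
  (hov : o ≠ v) (huv : u ≠ v) (hou : o ≠ u) (hoh : o ≠ h) (huh : u ≠ h) (hvh : v ≠ h)
include hwv hwh hov huv hou hoh huh hvh

/-- **`P(N ≤ 1)`** for the haired ear at the observer, in terms of the three pair weights and six off-`Z` events. [this work] -/
theorem real_card_le_one_eq {A : Finset (Fin n)} (hvA : v ∈ A) (hhA : h ∈ A) :
    (prodBernoulli w).real {ω : BondConfig (Fin n) | (A.filter fun a => ω ∈ openConn o a).card ≤ 1} =
      (w s(o, v) : ℝ) * (w s(v, u) * (1 - w s(u, h))) *
          (prodBernoulli w).real {ω | (((A.erase v).erase h).filter fun a => offZ {v, h} ω ∈ openConn o a).card = 0 ∧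
            (((A.erase v).erase h).filter fun b => ¬ (openGraph (offZ {v, h} ω)).Reachable o b ∧
              (openGraph (offZ {v, h} ω)).Reachable u b).card = 0} +
        (w s(o, v) : ℝ) * ((1 - w s(v, u)) * w s(u, h)) *
          (prodBernoulli w).real {ω | ¬ (openGraph (offZ {v, h} ω)).Reachable o u ∧
            (((A.erase v).erase h).filter fun a => offZ {v, h} ω ∈ openConn o a).card = 0} +
        (w s(o, v) : ℝ) * ((1 - w s(v, u)) * (1 - w s(u, h))) *
          (prodBernoulli w).real {ω | (((A.erase v).erase h).filter fun a => offZ {v, h} ω ∈ openConn o a).card = 0} +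
        (1 - (w s(o, v) : ℝ)) * (w s(v, u) * w s(u, h)) *
          (prodBernoulli w).real {ω | ¬ (openGraph (offZ {v, h} ω)).Reachable o u ∧
            (((A.erase v).erase h).filter fun a => offZ {v, h} ω ∈ openConn o a).card ≤ 1} +
        ((1 - (w s(o, v) : ℝ)) * (w s(v, u) * (1 - w s(u, h))) + (1 - (w s(o, v) : ℝ)) * ((1 - w s(v, u)) * w s(u, h))) *
          (prodBernoulli w).real {ω | (¬ (openGraph (offZ {v, h} ω)).Reachable o u ∧
              (((A.erase v).erase h).filter fun a => offZ {v, h} ω ∈ openConn o a).card ≤ 1) ∨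
            ((openGraph (offZ {v, h} ω)).Reachable o u ∧
              (((A.erase v).erase h).filter fun a => offZ {v, h} ω ∈ openConn o a).card = 0)} +
        (1 - (w s(o, v) : ℝ)) * ((1 - w s(v, u)) * (1 - w s(u, h))) *
          (prodBernoulli w).real {ω | (((A.erase v).erase h).filter fun a => offZ {v, h} ω ∈ openConn o a).card ≤ 1} := by
  set μ := prodBernoulli w with hμ
  have hmeas : ∀ U : Set (BondConfig (Fin n)), MeasurableSet U := fun U => (Set.toFinite U).measurableSet
  -- notation for the off-`Z` data as functions of `ω`
  set Kf : BondConfig (Fin n) → ℕ := fun ω => (((A.erase v).erase h).filter fun a => offZ {v, h} ω ∈ openConn o a).card with hKf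
  set Ff : BondConfig (Fin n) → ℕ := fun ω => (((A.erase v).erase h).filter fun b =>
    ¬ (openGraph (offZ {v, h} ω)).Reachable o b ∧ (openGraph (offZ {v, h} ω)).Reachable u b).card with hFf
  set Gp : BondConfig (Fin n) → Prop := fun ω => (openGraph (offZ {v, h} ω)).Reachable o u with hGp
  -- the coin states
  set E110 := {ω : BondConfig (Fin n) | s(o, v) ∈ ω ∧ s(v, u) ∈ ω ∧ s(u, h) ∉ ω} with hE110
  set E101 := {ω : BondConfig (Fin n) | s(o, v) ∈ ω ∧ s(v, u) ∉ ω ∧ s(u, h) ∈ ω} with hE101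
  set E100 := {ω : BondConfig (Fin n) | s(o, v) ∈ ω ∧ s(v, u) ∉ ω ∧ s(u, h) ∉ ω} with hE100
  set E011 := {ω : BondConfig (Fin n) | s(o, v) ∉ ω ∧ s(v, u) ∈ ω ∧ s(u, h) ∈ ω} with hE011
  set E010 := {ω : BondConfig (Fin n) | s(o, v) ∉ ω ∧ s(v, u) ∈ ω ∧ s(u, h) ∉ ω} with hE010
  set E001 := {ω : BondConfig (Fin n) | s(o, v) ∉ ω ∧ s(v, u) ∉ ω ∧ s(u, h) ∈ ω} with hE001
  set E000 := {ω : BondConfig (Fin n) | s(o, v) ∉ ω ∧ s(v, u) ∉ ω ∧ s(u, h) ∉ ω} with hE000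
  -- the off-`Z` events
  set X00 := {ω : BondConfig (Fin n) | Kf ω = 0 ∧ Ff ω = 0} with hX00
  set X0 := {ω : BondConfig (Fin n) | ¬ Gp ω ∧ Kf ω = 0} with hX0
  set X0c := {ω : BondConfig (Fin n) | Kf ω = 0} with hX0c
  set X1 := {ω : BondConfig (Fin n) | ¬ Gp ω ∧ Kf ω ≤ 1} with hX1
  set X1c := {ω : BondConfig (Fin n) | (¬ Gp ω ∧ Kf ω ≤ 1) ∨ (Gp ω ∧ Kf ω = 0)} with hX1c
  set X2 := {ω : BondConfig (Fin n) | Kf ω ≤ 1} with hX2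
  set S := {ω : BondConfig (Fin n) | (A.filter fun a => ω ∈ openConn o a).card ≤ 1} with hS
  set T := E110 ∩ X00 ∪ E101 ∩ X0 ∪ E100 ∩ X0c ∪ E011 ∩ X1 ∪ E010 ∩ X1c ∪ E001 ∩ X1c ∪ E000 ∩ X2 with hT
  -- Step 1: `S = T` on good configurations
  have hST : μ.real S = μ.real T := by
    refine real_congr_of_good w hwv hwh S T fun ω hωv hωh => ?_
    have hN := card_eq hωv hωh hov huv hou hoh huh hvh hvA hhA
    simp only [hS, Set.mem_setOf_eq]
    rw [hN]
    simp only [hT, hE110, hE101, hE100, hE011, hE010, hE001, hE000, hX00, hX0, hX0c, hX1, hX1c, hX2, hKf, hFf, hGp,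
      Set.mem_union, Set.mem_inter_iff, Set.mem_setOf_eq]
    by_cases hp : s(o, v) ∈ ω <;> by_cases hr : s(v, u) ∈ ω <;> by_cases hs : s(u, h) ∈ ω <;>
      by_cases hG : (openGraph (offZ {v, h} ω)).Reachable o u <;>
      simp only [hp, hr, hs, hG, or_true, true_and, and_true, false_or, or_false, false_and, and_false,
        not_true_eq_false, not_false_eq_true, if_true, if_false, and_self, iff_false, not_le] <;> omega
  -- Step 2: the seven pieces are pairwise disjoint (distinct coin states)
  have hTsum : μ.real T = μ.real (E110 ∩ X00) + μ.real (E101 ∩ X0) + μ.real (E100 ∩ X0c) + μ.real (E011 ∩ X1) +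
      μ.real (E010 ∩ X1c) + μ.real (E001 ∩ X1c) + μ.real (E000 ∩ X2) := by
    have d7 : Disjoint (E110 ∩ X00 ∪ E101 ∩ X0 ∪ E100 ∩ X0c ∪ E011 ∩ X1 ∪ E010 ∩ X1c ∪ E001 ∩ X1c) (E000 ∩ X2) := by
      rw [Set.disjoint_left]
      rintro ω (((((⟨⟨h1, -, -⟩, -⟩ | ⟨⟨h1, -, -⟩, -⟩) | ⟨⟨h1, -, -⟩, -⟩) | ⟨⟨-, h2, -⟩, -⟩) | ⟨⟨-, h2, -⟩, -⟩) | ⟨⟨-, -, h3⟩, -⟩)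
        ⟨⟨h1', h2', h3'⟩, -⟩
      · exact h1' h1
      · exact h1' h1
      · exact h1' h1
      · exact h2' h2
      · exact h2' h2
      · exact h3' h3
    have d6 : Disjoint (E110 ∩ X00 ∪ E101 ∩ X0 ∪ E100 ∩ X0c ∪ E011 ∩ X1 ∪ E010 ∩ X1c) (E001 ∩ X1c) := by
      rw [Set.disjoint_left]
      rintro ω ((((⟨⟨h1, -, -⟩, -⟩ | ⟨⟨h1, -, -⟩, -⟩) | ⟨⟨h1, -, -⟩, -⟩) | ⟨⟨-, h2, -⟩, -⟩) | ⟨⟨-, h2, -⟩, -⟩)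
        ⟨⟨h1', h2', -⟩, -⟩
      · exact h1' h1
      · exact h1' h1
      · exact h1' h1
      · exact h2' h2
      · exact h2' h2
    have d5 : Disjoint (E110 ∩ X00 ∪ E101 ∩ X0 ∪ E100 ∩ X0c ∪ E011 ∩ X1) (E010 ∩ X1c) := by
      rw [Set.disjoint_left]
      rintro ω (((⟨⟨h1, -, -⟩, -⟩ | ⟨⟨h1, -, -⟩, -⟩) | ⟨⟨h1, -, -⟩, -⟩) | ⟨⟨-, -, h3⟩, -⟩) ⟨⟨h1', -, h3'⟩, -⟩
      · exact h1' h1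
      · exact h1' h1
      · exact h1' h1
      · exact h3' h3
    have d4 : Disjoint (E110 ∩ X00 ∪ E101 ∩ X0 ∪ E100 ∩ X0c) (E011 ∩ X1) := by
      rw [Set.disjoint_left]
      rintro ω ((⟨⟨h1, -, -⟩, -⟩ | ⟨⟨h1, -, -⟩, -⟩) | ⟨⟨h1, -, -⟩, -⟩) ⟨⟨h1', -, -⟩, -⟩
      · exact h1' h1
      · exact h1' h1
      · exact h1' h1
    have d3 : Disjoint (E110 ∩ X00 ∪ E101 ∩ X0) (E100 ∩ X0c) := by
      rw [Set.disjoint_left]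
      rintro ω (⟨⟨-, h2, -⟩, -⟩ | ⟨⟨-, -, h3⟩, -⟩) ⟨⟨-, h2', h3'⟩, -⟩
      · exact h2' h2
      · exact h3' h3
    have d2 : Disjoint (E110 ∩ X00) (E101 ∩ X0) := by
      rw [Set.disjoint_left]
      rintro ω ⟨⟨-, h2, -⟩, -⟩ ⟨⟨-, h2', -⟩, -⟩
      exact h2' h2
    rw [hT, measureReal_union d7 (hmeas _), measureReal_union d6 (hmeas _), measureReal_union d5 (hmeas _),
      measureReal_union d4 (hmeas _), measureReal_union d3 (hmeas _), measureReal_union d2 (hmeas _)]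
  -- Step 3: each piece factors (independence of the pairs and the off-`Z` data)
  have h110 : μ.real (E110 ∩ X00) = (w s(o, v) : ℝ) * (w s(v, u) * (1 - w s(u, h))) * μ.real X00 := by
    rw [hμ, ← real_state_ooc (o := o) (v := v) (u := u) (h := h) w hou hoh hvh]
    exact real_inter_coins_off w (fun a b c => a ∧ b ∧ ¬ c) (fun η =>
      (((A.erase v).erase h).filter fun a => η ∈ openConn o a).card = 0 ∧
        (((A.erase v).erase h).filter fun b => ¬ (openGraph η).Reachable o b ∧ (openGraph η).Reachable u b).card = 0)
  have h101 : μ.real (E101 ∩ X0) = (w s(o, v) : ℝ) * ((1 - w s(v, u)) * w s(u, h)) * μ.real X0 := by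
    rw [hμ, ← real_state_oco (o := o) (v := v) (u := u) (h := h) w hou hoh hvh]
    exact real_inter_coins_off w (fun a b c => a ∧ ¬ b ∧ c) (fun η =>
      ¬ (openGraph η).Reachable o u ∧ (((A.erase v).erase h).filter fun a => η ∈ openConn o a).card = 0)
  have h100 : μ.real (E100 ∩ X0c) = (w s(o, v) : ℝ) * ((1 - w s(v, u)) * (1 - w s(u, h))) * μ.real X0c := by
    rw [hμ, ← real_state_occ (o := o) (v := v) (u := u) (h := h) w hou hoh hvh]
    exact real_inter_coins_off w (fun a b c => a ∧ ¬ b ∧ ¬ c) (fun η =>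
      (((A.erase v).erase h).filter fun a => η ∈ openConn o a).card = 0)
  have h011 : μ.real (E011 ∩ X1) = (1 - (w s(o, v) : ℝ)) * (w s(v, u) * w s(u, h)) * μ.real X1 := by
    rw [hμ, ← real_state_coo (o := o) (v := v) (u := u) (h := h) w hou hoh hvh]
    exact real_inter_coins_off w (fun a b c => ¬ a ∧ b ∧ c) (fun η =>
      ¬ (openGraph η).Reachable o u ∧ (((A.erase v).erase h).filter fun a => η ∈ openConn o a).card ≤ 1)
  have h010 : μ.real (E010 ∩ X1c) = (1 - (w s(o, v) : ℝ)) * (w s(v, u) * (1 - w s(u, h))) * μ.real X1c := by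
    rw [hμ, ← real_state_coc (o := o) (v := v) (u := u) (h := h) w hou hoh hvh]
    exact real_inter_coins_off w (fun a b c => ¬ a ∧ b ∧ ¬ c) (fun η =>
      (¬ (openGraph η).Reachable o u ∧ (((A.erase v).erase h).filter fun a => η ∈ openConn o a).card ≤ 1) ∨
        ((openGraph η).Reachable o u ∧ (((A.erase v).erase h).filter fun a => η ∈ openConn o a).card = 0))
  have h001 : μ.real (E001 ∩ X1c) = (1 - (w s(o, v) : ℝ)) * ((1 - w s(v, u)) * w s(u, h)) * μ.real X1c := by
    rw [hμ, ← real_state_cco (o := o) (v := v) (u := u) (h := h) w hou hoh hvh]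
    exact real_inter_coins_off w (fun a b c => ¬ a ∧ ¬ b ∧ c) (fun η =>
      (¬ (openGraph η).Reachable o u ∧ (((A.erase v).erase h).filter fun a => η ∈ openConn o a).card ≤ 1) ∨
        ((openGraph η).Reachable o u ∧ (((A.erase v).erase h).filter fun a => η ∈ openConn o a).card = 0))
  have h000 : μ.real (E000 ∩ X2) = (1 - (w s(o, v) : ℝ)) * ((1 - w s(v, u)) * (1 - w s(u, h))) * μ.real X2 := by
    rw [hμ, ← real_state_ccc (o := o) (v := v) (u := u) (h := h) w hou hoh hvh]
    exact real_inter_coins_off w (fun a b c => ¬ a ∧ ¬ b ∧ ¬ c) (fun η =>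
      (((A.erase v).erase h).filter fun a => η ∈ openConn o a).card ≤ 1)
  rw [hST, hTsum, h110, h101, h100, h011, h010, h001, h000]
  ring

end Law

end EarHair

open Finset MeasureTheory Set
open Literature.Probability.LatticeModels
open Literature.Probability.Percolation
open Bundle (offZ)
open scoped Classical

variable {n : ℕ}


/-- **FAR at layer one with a haired ear at the observer.**  If `v ∈ A` (`v ≠ o`) has positive weight only on `s(o, v)` and `s(v, u)`
(`u ≠ o, v`), and `h ∈ A` is pendant at `u` (positive weight only on `s(u, h)`), then `2 < Σ_{a∈A} P(o ↔ a)` and `P(o ↮ a) ≤ t` on `A`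
imply `P(#{a ∈ A : o ↔ a} ≤ 1) ≤ t`. [this work] -/
theorem farLayerOne_of_earHairAtObserver (w : Sym2 (Fin n) → unitInterval) (A : Finset (Fin n)) {o v u h : Fin n}
    (hov : o ≠ v) (huv : u ≠ v) (hou : o ≠ u) (hoh : o ≠ h) (huh : u ≠ h) (hvh : v ≠ h) (hvA : v ∈ A) (hhA : h ∈ A)
    (hwv : ∀ z : Fin n, z ≠ o → z ≠ u → z ≠ v → (w s(v, z) : ℝ) = 0) (hwh : ∀ z : Fin n, z ≠ u → z ≠ h → (w s(h, z) : ℝ) = 0) (t : ℝ)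
    (hEN : 2 < ∑ a ∈ A, (prodBernoulli w).real (openConn o a))
    (hcut : ∀ a ∈ A, (prodBernoulli w).real (openConn o a : Set (BondConfig (Fin n)))ᶜ ≤ t) :
    (prodBernoulli w).real {ω : BondConfig (Fin n) | (A.filter fun a => ω ∈ openConn o a).card ≤ 1} ≤ t := by
  set μ := prodBernoulli w with hμ
  have hmeas : ∀ U : Set (BondConfig (Fin n)), MeasurableSet U := fun U => (Set.toFinite U).measurableSet
  -- the three pair weights
  set p : ℝ := (w s(o, v) : ℝ) with hp
  set r : ℝ := (w s(v, u) : ℝ) with hr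
  set s : ℝ := (w s(u, h) : ℝ) with hs
  have hp0 : 0 ≤ p := (w s(o, v)).2.1
  have hp1 : p ≤ 1 := (w s(o, v)).2.2
  have hr0 : 0 ≤ r := (w s(v, u)).2.1
  have hr1 : r ≤ 1 := (w s(v, u)).2.2
  have hs0 : 0 ≤ s := (w s(u, h)).2.1
  have hs1 : s ≤ 1 := (w s(u, h)).2.2
  have hpr0 : 0 ≤ p * r := mul_nonneg hp0 hr0
  have hpr1 : p * r ≤ 1 := by nlinarith
  -- the off-`Z` data
  set A'' := (A.erase v).erase h with hA''
  set Kf : BondConfig (Fin n) → ℕ := fun ω => (A''.filter fun a => offZ {v, h} ω ∈ openConn o a).card with hKf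
  set Ff : BondConfig (Fin n) → ℕ := fun ω => (A''.filter fun b =>
    ¬ (openGraph (offZ {v, h} ω)).Reachable o b ∧ (openGraph (offZ {v, h} ω)).Reachable u b).card with hFf
  set Gp : BondConfig (Fin n) → Prop := fun ω => (openGraph (offZ {v, h} ω)).Reachable o u with hGp
  have hGF : ∀ ω, Gp ω → Ff ω = 0 := fun ω hG => EarHair.feed_eq_zero_of_reach (o := o) (u := u) (offZ {v, h} ω) A'' hG
  -- the cells
  set x00 := μ.real {ω | ¬ Gp ω ∧ Kf ω = 0 ∧ Ff ω = 0} with hx00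
  set x01 := μ.real {ω | ¬ Gp ω ∧ Kf ω = 0 ∧ 1 ≤ Ff ω} with hx01
  set a1 := μ.real {ω | ¬ Gp ω ∧ Kf ω = 1} with ha1
  set a2 := μ.real {ω | ¬ Gp ω ∧ 2 ≤ Kf ω} with ha2
  set c := μ.real {ω | Gp ω ∧ Kf ω = 0} with hc
  set d1 := μ.real {ω | Gp ω ∧ Kf ω = 1} with hd1
  set d2 := μ.real {ω | Gp ω ∧ 2 ≤ Kf ω} with hd2
  set g := μ.real {ω | Gp ω} with hg
  obtain ⟨c1, c2, c3, c4, c5, c6, c7, c8, c9, c10, c11⟩ := EarHair.cells μ Gp Kf Ff hGF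
  rw [probReal_univ] at c9
  have hone : x00 + x01 + a1 + a2 + c + d1 + d2 = 1 := by linarith
  have hgdef : g = c + d1 + d2 := c7
  -- the marginals (file II)
  have eG : {ω : BondConfig (Fin n) | offZ {v, h} ω ∈ openConn o u} = {ω | Gp ω} := rfl
  have hqv : μ.real (openConn o v) = p + (1 - p) * r * g := by
    have e := EarHair.real_openConn_v_eq w hwv hwh hov huv hou hoh huh hvh; rw [eG] at e; exact e
  have hqh : μ.real (openConn o h) = s * (p * r + (1 - p * r) * g) := by
    have e := EarHair.real_openConn_h_eq w hwv hwh hov huv hou hoh huh hvh; rw [eG] at e; rw [e]; ring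
  have hqb : ∀ b ∈ A'', μ.real (openConn o b) = μ.real {ω : BondConfig (Fin n) | offZ {v, h} ω ∈ openConn o b} +
      p * r * μ.real {ω : BondConfig (Fin n) | ¬ (openGraph (offZ {v, h} ω)).Reachable o b ∧ (openGraph (offZ {v, h} ω)).Reachable u b} := by
    intro b hb
    have hbv : b ≠ v := (mem_erase.1 (mem_erase.1 hb).2).1
    have hbh : b ≠ h := (mem_erase.1 hb).1
    exact EarHair.real_openConn_of_ne w hwv hwh hov huv hou hoh huh hvh hbv hbh
  -- splitting the mean
  have hhA' : h ∈ A.erase v := mem_erase.2 ⟨hvh.symm, hhA⟩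
  set S : ℝ := ∑ b ∈ A'', μ.real (openConn o b) with hS
  have hsumA : ∑ a ∈ A, μ.real (openConn o a) = μ.real (openConn o v) + μ.real (openConn o h) + S := by
    rw [← add_sum_erase A _ hvA, ← add_sum_erase (A.erase v) _ hhA', add_assoc]
  have hSeq : S = (∑ b ∈ A'', μ.real {ω : BondConfig (Fin n) | offZ {v, h} ω ∈ openConn o b}) +
      p * r * (∑ b ∈ A'', μ.real {ω : BondConfig (Fin n) |
        ¬ (openGraph (offZ {v, h} ω)).Reachable o b ∧ (openGraph (offZ {v, h} ω)).Reachable u b}) := by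
    rw [hS, mul_sum, ← sum_add_distrib]; exact sum_congr rfl hqb
  -- the first-moment bound (file IV)
  set N : ℝ := (A''.card : ℝ) with hN
  have hSub : S ≤ p * r * N * x01 + (1 - p * r + p * r * N) * a1 + N * a2 + d1 + N * d2 := by
    have e := EarHair.sum_real_le (o := o) (u := u) (v := v) (h := h) μ A hpr0 hpr1
    rw [hSeq]; linarith [e]
  -- Harris (file IV)
  have hHar : g * (a1 + a2 + d1 + d2) ≤ d1 + d2 := by
    have e := EarHair.real_harris (o := o) (u := u) (v := v) (h := h) w A''
    rw [eG] at e
    have e10 : μ.real {ω | 1 ≤ Kf ω} = a1 + a2 + (d1 + d2) := c10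
    have e11 : μ.real ({ω | Gp ω} ∩ {ω | 1 ≤ Kf ω}) = d1 + d2 := c11
    rw [← hμ, e10, e11] at e; linarith
  -- the law of `N ≤ 1` (file III)
  have hN1 : μ.real {ω : BondConfig (Fin n) | (A.filter fun a => ω ∈ openConn o a).card ≤ 1} =
      1 - (p * r * s * x00 + p * r * x01 + p * a1 + a2 + (1 - (1 - p) * (1 - r)) * s * c + (1 - (1 - p) * (1 - r) * (1 - s)) * d1 + d2) := by
    rw [EarHair.real_card_le_one_eq w hwv hwh hov huv hou hoh huh hvh hvA hhA]
    have e1 : μ.real {ω | Kf ω = 0 ∧ Ff ω = 0} = x00 + c := c1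
    have e2 : μ.real {ω | ¬ Gp ω ∧ Kf ω = 0} = x00 + x01 := c2
    have e3 : μ.real {ω | Kf ω = 0} = x00 + x01 + c := by rw [c3, c2]
    have e4 : μ.real {ω | ¬ Gp ω ∧ Kf ω ≤ 1} = x00 + x01 + a1 := by rw [c4, c2]
    have e5 : μ.real {ω | (¬ Gp ω ∧ Kf ω ≤ 1) ∨ (Gp ω ∧ Kf ω = 0)} = x00 + x01 + a1 + c := by rw [c5, c4, c2]
    have e6 : μ.real {ω | Kf ω ≤ 1} = x00 + x01 + a1 + c + d1 := by rw [c6, c5, c4, c2]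
    show _ * μ.real {ω | Kf ω = 0 ∧ Ff ω = 0} + _ * μ.real {ω | ¬ Gp ω ∧ Kf ω = 0} + _ * μ.real {ω | Kf ω = 0} +
      _ * μ.real {ω | ¬ Gp ω ∧ Kf ω ≤ 1} + _ * μ.real {ω | (¬ Gp ω ∧ Kf ω ≤ 1) ∨ (Gp ω ∧ Kf ω = 0)} + _ * μ.real {ω | Kf ω ≤ 1} = _
    rw [e1, e2, e3, e4, e5, e6]
    linear_combination hone
  -- marginal lower bounds from the cut hypothesis
  have hcomp : ∀ a : Fin n, μ.real (openConn o a : Set (BondConfig (Fin n)))ᶜ = 1 - μ.real (openConn o a) :=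
    fun a => probReal_compl_eq_one_sub (hmeas _)
  have hxv : 1 - t ≤ p + (1 - p) * r * g := by have e := hcut v hvA; rw [hcomp, hqv] at e; linarith
  have hxh : 1 - t ≤ s * (p * r + (1 - p * r) * g) := by have e := hcut h hhA; rw [hcomp, hqh] at e; linarith
  have hSx : N * (1 - t) ≤ S := by
    have h1 : ∀ b ∈ A'', 1 - t ≤ μ.real (openConn o b) := by
      intro b hb; have e := hcut b (mem_of_mem_erase (mem_of_mem_erase hb)); rw [hcomp] at e; linarith
    have e := sum_le_sum h1
    rw [sum_const, nsmul_eq_mul] at e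
    exact e
  have hEN' : 2 < (p + (1 - p) * r * g) + s * (p * r + (1 - p * r) * g) + S := by rw [hsumA, hqv, hqh] at hEN; exact hEN
  -- nonnegativity of the cells
  have hx00n : 0 ≤ x00 := measureReal_nonneg
  have hx01n : 0 ≤ x01 := measureReal_nonneg
  have ha1n : 0 ≤ a1 := measureReal_nonneg
  have ha2n : 0 ≤ a2 := measureReal_nonneg
  have hcn : 0 ≤ c := measureReal_nonneg
  have hd1n : 0 ≤ d1 := measureReal_nonneg
  have hd2n : 0 ≤ d2 := measureReal_nonneg
  rw [hN1]
  -- case analysis on the number of outside relays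
  rcases Nat.lt_or_ge A''.card 2 with hlt | hge
  · rcases Nat.lt_or_ge A''.card 1 with h0 | h1
    · -- no outside relay: the mean cannot exceed 2
      exfalso
      have hA0 : A'' = ∅ := by rw [← card_eq_zero]; omega
      have hS0 : S = 0 := by rw [hS, hA0, sum_empty]
      have hv1 : μ.real (openConn o v) ≤ 1 := measureReal_le_one
      have hh1 : μ.real (openConn o h) ≤ 1 := measureReal_le_one
      rw [hqv] at hv1; rw [hqh] at hh1
      rw [hS0] at hEN'
      linarith
    · -- one outside relay: the cells `a₂, d₂` are empty
      have hcard : A''.card = 1 := by omega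
      have hN1' : N = 1 := by rw [hN, hcard]; norm_num
      have hK1 : ∀ ω, Kf ω ≤ 1 := fun ω => (card_filter_le _ _).trans hcard.le
      have ha20 : a2 = 0 := by
        have : {ω | ¬ Gp ω ∧ 2 ≤ Kf ω} = (∅ : Set (BondConfig (Fin n))) := by
          ext ω; simp only [Set.mem_setOf_eq, Set.mem_empty_iff_false, iff_false, not_and, not_le]
          exact fun _ => Nat.lt_of_le_of_lt (hK1 ω) (by norm_num)
        rw [ha2, this, measureReal_empty]
      have hd20 : d2 = 0 := by
        have : {ω | Gp ω ∧ 2 ≤ Kf ω} = (∅ : Set (BondConfig (Fin n))) := by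
          ext ω; simp only [Set.mem_setOf_eq, Set.mem_empty_iff_false, iff_false, not_and, not_le]
          exact fun _ => Nat.lt_of_le_of_lt (hK1 ω) (by norm_num)
        rw [hd2, this, measureReal_empty]
      rw [hN1'] at hSub hSx
      rw [ha20, hd20] at hone hSub hHar
      have key := EarHair.arith_master_one (x := 1 - t) (S := S) (qv := p + (1 - p) * r * g) (qh := s * (p * r + (1 - p * r) * g))
        (Sub := p * r * x01 + a1 + d1)
        (P := p * r * s * x00 + p * r * x01 + p * a1 + (1 - (1 - p) * (1 - r)) * s * c + (1 - (1 - p) * (1 - r) * (1 - s)) * d1)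
        hp0 hp1 hr0 hr1 hs0 hs1 rfl hx00n hx01n ha1n hcn hd1n (by linarith) (by rw [hgdef, hd20]; ring) (by ring) rfl rfl rfl
        (by linarith) hxv hxh (by linarith) (by linarith) hEN'
      rw [ha20, hd20]; linarith
  · -- at least two outside relays
    have hN2 : (2 : ℝ) ≤ N := by rw [hN]; exact_mod_cast hge
    have key := EarHair.arith_master_two (x := 1 - t) (S := S) (qv := p + (1 - p) * r * g) (qh := s * (p * r + (1 - p * r) * g))
      (Sub := p * r * N * x01 + (1 - p * r + p * r * N) * a1 + N * a2 + d1 + N * d2)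
      (P := p * r * s * x00 + p * r * x01 + p * a1 + a2 + (1 - (1 - p) * (1 - r)) * s * c + (1 - (1 - p) * (1 - r) * (1 - s)) * d1 + d2)
      hp0 hp1 hr0 hr1 hs0 hs1 rfl hN2 hx00n hx01n ha1n ha2n hcn hd1n hd2n hone hgdef (by ring) rfl rfl rfl hHar hxv hxh hSx hSub hEN'
    linarith

/-- The same in the `(2·j < EN)` form of `Quant.FarRelayRow` at `j = 1`. [this work] -/
theorem farRelayRow_one_of_earHairAtObserver (w : Sym2 (Fin n) → unitInterval) (A : Finset (Fin n)) {o v u h : Fin n}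
    (hov : o ≠ v) (huv : u ≠ v) (hou : o ≠ u) (hoh : o ≠ h) (huh : u ≠ h) (hvh : v ≠ h) (hvA : v ∈ A) (hhA : h ∈ A)
    (hwv : ∀ z : Fin n, z ≠ o → z ≠ u → z ≠ v → (w s(v, z) : ℝ) = 0) (hwh : ∀ z : Fin n, z ≠ u → z ≠ h → (w s(h, z) : ℝ) = 0) (t : ℝ)
    (hEN : (2 * (1 : ℕ) : ℝ) < ∑ a ∈ A, (prodBernoulli w).real (openConn o a))
    (hcut : ∀ a ∈ A, (prodBernoulli w).real (openConn o a : Set (BondConfig (Fin n)))ᶜ ≤ t) :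
    (prodBernoulli w).real {ω : BondConfig (Fin n) | (A.filter fun a => ω ∈ openConn o a).card ≤ 1} ≤ t :=
  farLayerOne_of_earHairAtObserver w A hov huv hou hoh huh hvh hvA hhA hwv hwh t (by push_cast at hEN; linarith) hcut

end Quant

end Summit.CriticalPhenomena.PercolationContinuityZ3.Theorems
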